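import Literature.NumberTheory.EllipticCurves.SingularModuliWeberSquareRoot
import Literature.NumberTheory.EllipticCurves.SingularModuliWeberCubeRootInert
import Literature.NumberTheory.NumberFields.IdealSquareOfOddDegree
import HarnessLib

/-!
# `(j(τ) − 1728)` is a square ideal in `𝓞_{H_K}` for `d_K ≡ 5 (mod 8)`
# (Weber's `γ₃ = √(j − 1728)`, the case `2` inert in `K`, through an odd-degree extension of `H_K`)

Topic `NumberTheory/EllipticCurves` (complex multiplication), namespace
`Literature.NumberTheory.EllipticCurves`.  Theorems only (no definition, no named fact).

`SingularModuliWeberSquareRoot.lean` shows `j(τ_{Q₀}) − 1728 = w²` with `w ∈ H_K` for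
`d_K ≡ 1 (mod 8)` (`2` split), through level-`4` Heegner points.  For `d_K ≡ 5 (mod 8)` (`2` inert)
there are none, and the element statement (classically `γ₃(τ₀) ∈ H_K` for odd `d_K`, Birch–Schertz)
needs Shimura reciprocity for the full level-`2` structure, which the tree does not have.  This
file proves the **ideal** statement — all that the discriminant bound of Granville–Stark needs —
by an odd-degree trick:

* `P = τ_{Q₀}/2 = τ_{(4a, 2b, c)}` (`Q₀ = (a, b, c)`, all odd as `d_K ≡ 5 (mod 8)`) is a CM point of
  level `4` for the order of conductor `2`, with `gcd(4, ac) = 1`; the Bezout-form transport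
  (`HeegnerPointsLevelTransportOrders`) and the `Aut(ℂ)`-invariance of the `q`-series of
  `u₄ = γ₃(2τ) ∈ K_4` (`mapLaurent_weberFourFn`) give: every automorphism of `ℂ` fixing `H_K` and
  `x := j(P)` fixes `g := u₄(P) = γ₃(τ_{Q₀})`, `g² = j(τ_{Q₀}) − 1728`
  (`apply_weberFourValue_half_eq`); hence `g ∈ M := H_K(x)` (`weberFourValue_half_mem_adjoin`);
* `r := [M : H_K] ∈ {1, 3}` (`finrank_adjoin_odd`): `x` is a root of `Φ₂(X, y) ∈ H_K[X]`,
  `y = j(τ_{Q₀})`, of degree `3`; and `r ≠ 2`, for otherwise the linear cofactor of the minimal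
  polynomial of `x` has a root `c ∈ H_K`, one of the three roots `j(2τ)`, `j(τ/2)`, `j((τ+1)/2)`,
  which are singular moduli of *primitive* forms of discriminant `4d_K` (here `2` inert enters),
  all conjugate to `x` over `ℚ`; as `H_K` is stable under `Aut(ℂ)`
  (`ringEquiv_apply_mem_singularModuliField`), `x ∈ H_K` and `r = 1`;
* so `[M : H_K]` is odd and `j(τ_{Q₀}) − 1728 = g²` with `g ∈ 𝓞_M`: by the fundamental identity
  `Σ e f = [M : H_K]` some prime of `M` over each prime of `H_K` has odd ramification index, whence
  every exponent in `(j(τ_{Q₀}) − 1728)` is even (`exists_span_eq_sq_of_odd_finrank`).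

Main results: `exists_span_formJ_sub_eq_sq_of_inert` (`d_K ≡ 5 (mod 8)`) and, with the split case,
`exists_span_formJ_sub_eq_sq_of_odd` — **for odd `d_K`, `(j(τ_{Q₀}) − 1728) = 𝔟²` in `𝓞 H_K`**.
Not covered: `d_K` even (`2` ramified: there `[M : H_K] = 2`).  Groundwork for the CM input (C)
of `Literature.Barriers.ABC.OWeakUniformABCImpliesNoSiegelZeros`.

## References

* D. A. Cox, *Primes of the form x² + ny²*, 2nd ed., 2013, §12.A (after Thm. 12.13: `γ₃`,
  "`γ₃(τ₀)` generates a field closely related to the ring class field", Schertz [A19, Thm. 3]),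
  §11.B (11.15), Thm. 7.24 (`h(4D) = 3h(D)` for `2` inert, not used). [Cox2013]
* G. Shimura, *Introduction to the arithmetic theory of automorphic functions*, 1971, §6.8.
  [ShimuraIATAF1971]
* J. Neukirch, *Algebraic Number Theory*, 1999, Ch. I Prop. 8.2. [NeukirchANT1999]
-/

noncomputable section

open Complex Polynomial NumberField
open UpperHalfPlane hiding I
open scoped MatrixGroups ModularForm Cardinal IntermediateField ComplexConjugate

universe u

namespace Literature.NumberTheory.EllipticCurves

open ModularForms Literature.FieldTheory.AlgClosed
open Literature.NumberTheory.QuadraticFields.BinaryQuadraticForm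
open Literature.NumberTheory.QuadraticFields.Quadratic (discr_emod_four)
open Literature.NumberTheory.NumberFields (exists_span_eq_sq_of_odd_finrank)

/-! ### Coordinates at level `2`: `√(4D) = 2√D`, the points `2τ`, `τ/2`, `(τ + 1)/2` -/

/-- `√(4D) = 2√D`. [folklore] -/
theorem sqrtDisc_four_mul (D : ℤ) : sqrtDisc (4 * D) = 2 * sqrtDisc D := by
  have h4 : Real.sqrt 4 = 2 := by
    rw [show (4 : ℝ) = 2 ^ 2 by norm_num, Real.sqrt_sq (by norm_num)]
  have h : Real.sqrt (-((4 * D : ℤ) : ℝ)) = 2 * Real.sqrt (-(D : ℝ)) := by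
    push_cast
    rw [show -(4 * (D : ℝ)) = 4 * (-(D : ℝ)) by ring, Real.sqrt_mul (by norm_num), h4]
  rw [sqrtDisc, sqrtDisc, h, Complex.ofReal_mul, Complex.ofReal_ofNat]
  ring

section Points

variable {a b c : ℤ}

/-- `τ_{Q₀}/2 = τ_{(4a, 2b, c)}` for `Q₀ = (a, b, c)`: the CM point `P` of level `4` of the order of
conductor `2`. [folklore] -/
theorem divPoint_two_zero_heegnerTau (ha : 0 < a) (hD : b ^ 2 - 4 * a * c < 0) :
    divPoint 2 0 (heegnerTau (a, b, c)) = heegnerTau (4 * a, 2 * b, c) := by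
  have ha0 : (a : ℂ) ≠ 0 := by exact_mod_cast ha.ne'
  apply UpperHalfPlane.ext
  rw [coe_divPoint, coe_heegnerTau_eq (Q := (a, b, c)) (D := b ^ 2 - 4 * a * c) ha rfl hD,
    coe_heegnerTau_eq (Q := (4 * a, 2 * b, c)) (D := 4 * (b ^ 2 - 4 * a * c)) (by linarith)
      (by push_cast; ring) (by linarith), sqrtDisc_four_mul]
  push_cast
  field_simp
  ring

/-- `2τ_{Q₀} = τ_{(a, 2b, 4c)}`. [folklore] -/
theorem mulPoint_two_heegnerTau (ha : 0 < a) (hD : b ^ 2 - 4 * a * c < 0) :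
    mulPoint 2 (heegnerTau (a, b, c)) = heegnerTau (a, 2 * b, 4 * c) := by
  have ha0 : (a : ℂ) ≠ 0 := by exact_mod_cast ha.ne'
  apply UpperHalfPlane.ext
  rw [coe_mulPoint, coe_heegnerTau_eq (Q := (a, b, c)) (D := b ^ 2 - 4 * a * c) ha rfl hD,
    coe_heegnerTau_eq (Q := (a, 2 * b, 4 * c)) (D := 4 * (b ^ 2 - 4 * a * c)) ha
      (by push_cast; ring) (by linarith), sqrtDisc_four_mul]
  push_cast
  ring

/-- `(τ_{Q₀} + k)/2 = τ_{(4a, 2(b − 2ak), ak² − bk + c)}`. [folklore] -/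
theorem divPoint_two_heegnerTau (ha : 0 < a) (hD : b ^ 2 - 4 * a * c < 0) (k : ℤ) :
    divPoint 2 k (heegnerTau (a, b, c)) =
      heegnerTau (4 * a, 2 * (b - 2 * a * k), a * k ^ 2 - b * k + c) := by
  have ha0 : (a : ℂ) ≠ 0 := by exact_mod_cast ha.ne'
  apply UpperHalfPlane.ext
  rw [coe_divPoint, coe_heegnerTau_eq (Q := (a, b, c)) (D := b ^ 2 - 4 * a * c) ha rfl hD,
    coe_heegnerTau_eq (Q := (4 * a, 2 * (b - 2 * a * k), a * k ^ 2 - b * k + c))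
      (D := 4 * (b ^ 2 - 4 * a * c)) (by linarith) (by push_cast; ring) (by linarith),
    sqrtDisc_four_mul]
  push_cast
  field_simp
  ring

/-- `(tpD 2 • τ : ℂ) = 2τ`. [folklore] -/
theorem coe_tpD_two_smul (τ : ℍ) : ((tpD 2 • τ : ℍ) : ℂ) = 2 * (τ : ℂ) := by
  rw [coe_tpD_smul, Nat.cast_ofNat]

/-- `2 · P = τ_{Q₀}`: `tpD 2 • τ_{(4a, 2b, c)} = τ_{(a, b, c)}`. [folklore] -/
theorem tpD_two_smul_heegnerTau (ha : 0 < a) (hD : b ^ 2 - 4 * a * c < 0) :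
    tpD 2 • heegnerTau (4 * a, 2 * b, c) = heegnerTau (a, b, c) := by
  have ha0 : (a : ℂ) ≠ 0 := by exact_mod_cast ha.ne'
  apply UpperHalfPlane.ext
  rw [coe_tpD_two_smul, coe_heegnerTau_eq (Q := (a, b, c)) (D := b ^ 2 - 4 * a * c) ha rfl hD,
    coe_heegnerTau_eq (Q := (4 * a, 2 * b, c)) (D := 4 * (b ^ 2 - 4 * a * c)) (by linarith)
      (by push_cast; ring) (by linarith), sqrtDisc_four_mul]
  push_cast
  field_simp
  ring

end Points

/-! ### The forms of discriminant `4D` attached to `Q₀ = (a, b, c)` with `a, b, c` odd -/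

section Forms

variable {a b c : ℤ}

/-- A form with an odd coefficient among `A, C` is primitive as soon as its odd common divisors are
units. [folklore] -/
theorem isPrimitive_of_odd {A B C : ℤ} (hodd : Odd A ∨ Odd C)
    (h : ∀ d : ℤ, Odd d → d ∣ A → d ∣ B → d ∣ C → IsUnit d) : IsPrimitive (A, B, C) := by
  rw [isPrimitive_iff_binQF,
    _root_.Literature.NumberTheory.QuadraticFields.Quadratic.BinQF.isPrimitive_iff]
  intro d hdA hdB hdC
  dsimp only at hdA hdB hdC
  have hd : Odd d := by
    rcases hodd with hA | hC
    · obtain ⟨t, ht⟩ := hdA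
      rw [ht] at hA
      exact (Int.odd_mul.mp hA).1
    · obtain ⟨t, ht⟩ := hdC
      rw [ht] at hC
      exact (Int.odd_mul.mp hC).1
  exact h d hd hdA hdB hdC

/-- An odd integer is coprime to `2`. [folklore] -/
theorem isCoprime_two_of_odd {d : ℤ} (hd : Odd d) : IsCoprime d 2 :=
  Int.isCoprime_two_right.mpr hd

/-- An odd integer is coprime to `4`. [folklore] -/
theorem isCoprime_four_of_odd {d : ℤ} (hd : Odd d) : IsCoprime d 4 := by
  simpa using (isCoprime_two_of_odd hd).pow_right (n := 2)

/-- An odd divisor of `4a` divides `a`, an odd divisor of `2b` divides `b`. [folklore] -/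
theorem dvd_of_odd_dvd_four_mul {d a : ℤ} (hd : Odd d) (h : d ∣ 4 * a) : d ∣ a :=
  (isCoprime_four_of_odd hd).dvd_of_dvd_mul_left h

/-- An odd divisor of `2b` divides `b`. [folklore] -/
theorem dvd_of_odd_dvd_two_mul {d b : ℤ} (hd : Odd d) (h : d ∣ 2 * b) : d ∣ b :=
  (isCoprime_two_of_odd hd).dvd_of_dvd_mul_left h

/-- `a k² − b k + c` is odd for `a, b, c` odd. [folklore] -/
theorem odd_conjCoeff (hao : Odd a) (hbo : Odd b) (hco : Odd c) (k : ℤ) :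
    Odd (a * k ^ 2 - b * k + c) := by
  have he : Even (a * k ^ 2 - b * k) := by
    rcases Int.even_or_odd k with hk | hk
    · exact (hk.mul_left a |>.mul_right k |> fun h ↦ by
        rw [show a * k ^ 2 - b * k = (a * k) * k - b * k by ring]
        exact (Int.even_mul.mpr (Or.inr hk)).sub (Int.even_mul.mpr (Or.inr hk)))
    · rw [show a * k ^ 2 - b * k = (a * k - b) * k by ring]
      exact Int.even_mul.mpr (Or.inl ((hao.mul hk).sub_odd hbo))
  exact he.add_odd hco

/-- `(4a, 2b, c)` is primitive (`Q₀ = (a, b, c)` primitive, `c` odd). [folklore] -/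
theorem isPrimitive_half (hprim : IsPrimitive (a, b, c)) (hco : Odd c) :
    IsPrimitive (4 * a, 2 * b, c) := by
  rw [isPrimitive_iff_binQF,
    _root_.Literature.NumberTheory.QuadraticFields.Quadratic.BinQF.isPrimitive_iff] at hprim
  refine isPrimitive_of_odd (Or.inr hco) fun d hd hdA hdB hdC ↦ ?_
  exact hprim d (dvd_of_odd_dvd_four_mul hd hdA) (dvd_of_odd_dvd_two_mul hd hdB) hdC

/-- `(a, 2b, 4c)` is primitive (`Q₀` primitive, `a` odd). [folklore] -/
theorem isPrimitive_double (hprim : IsPrimitive (a, b, c)) (hao : Odd a) :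
    IsPrimitive (a, 2 * b, 4 * c) := by
  rw [isPrimitive_iff_binQF,
    _root_.Literature.NumberTheory.QuadraticFields.Quadratic.BinQF.isPrimitive_iff] at hprim
  refine isPrimitive_of_odd (Or.inl hao) fun d hd hdA hdB hdC ↦ ?_
  exact hprim d hdA (dvd_of_odd_dvd_two_mul hd hdB) (dvd_of_odd_dvd_four_mul hd hdC)

/-- `(4a, 2(b − 2ak), ak² − bk + c)` is primitive (`Q₀` primitive, `a, b, c` odd): in the inert case
all three lattices of index `2` have multiplier ring the order of conductor `2`. [folklore] -/
theorem isPrimitive_half_conj (hprim : IsPrimitive (a, b, c)) (hao : Odd a) (hbo : Odd b)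
    (hco : Odd c) (k : ℤ) :
    IsPrimitive (4 * a, 2 * (b - 2 * a * k), a * k ^ 2 - b * k + c) := by
  rw [isPrimitive_iff_binQF,
    _root_.Literature.NumberTheory.QuadraticFields.Quadratic.BinQF.isPrimitive_iff] at hprim
  refine isPrimitive_of_odd (Or.inr (odd_conjCoeff hao hbo hco k)) fun d hd hdA hdB hdC ↦ ?_
  have hda : d ∣ a := dvd_of_odd_dvd_four_mul hd hdA
  have hdb : d ∣ b := by
    have h1 : d ∣ b - 2 * a * k := dvd_of_odd_dvd_two_mul hd hdB
    have h2 : d ∣ 2 * a * k := dvd_mul_of_dvd_left (dvd_mul_of_dvd_right hda 2) k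
    simpa using dvd_add h1 h2
  have hdc : d ∣ c := by
    have h1 : d ∣ a * k ^ 2 - b * k :=
      dvd_sub (dvd_mul_of_dvd_left hda _) (dvd_mul_of_dvd_left hdb _)
    have := dvd_sub hdC h1
    simpa using this
  exact hprim d hda hdb hdc

/-- `(4a, 2b, c) ∈ heegnerForms 4 (4D)`: the CM point `τ_{Q₀}/2` of level `4` for the order of
conductor `2`. [folklore] -/
theorem half_mem_heegnerForms (ha : 0 < a) (hprim : IsPrimitive (a, b, c)) (hco : Odd c) :
    ((4 * a : ℤ), 2 * b, c) ∈ heegnerForms 4 (4 * (b ^ 2 - 4 * a * c)) := by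
  have hp := isPrimitive_half hprim hco
  rw [isPrimitive_iff_binQF,
    _root_.Literature.NumberTheory.QuadraticFields.Quadratic.BinQF.isPrimitive_iff] at hp
  exact ⟨by push_cast; ring, by linarith, by push_cast; exact dvd_mul_right 4 a, hp⟩

/-- Oddness of `a, b, c` for a primitive form of discriminant `D ≡ 5 (mod 8)`. [folklore] -/
theorem odd_of_discr_emod_eight (hD8 : (b ^ 2 - 4 * a * c) % 8 = 5) : Odd a ∧ Odd b ∧ Odd c := by
  obtain ⟨P, hP⟩ : ∃ P, a * c = P := ⟨_, rfl⟩
  obtain ⟨B, hB⟩ : ∃ B, b ^ 2 = B := ⟨_, rfl⟩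
  have hD8' : (B - 4 * P) % 8 = 5 := by
    rw [← hB, ← hP, show 4 * (a * c) = 4 * a * c by ring]; exact hD8
  have hbo : Odd b := by
    have : Odd (b ^ 2) := by
      rw [hB]; exact Int.odd_iff.mpr (by omega)
    rw [pow_two] at this
    exact (Int.odd_mul.mp this).1
  obtain ⟨k, hk⟩ := hbo
  obtain ⟨m, hm⟩ := Int.even_mul_succ_self k
  have hsq : B = 8 * m + 1 := by
    rw [← hB, hk]
    have : (2 * k + 1) ^ 2 = 4 * (k * (k + 1)) + 1 := by ring
    rw [this, hm]; ring
  have hac : Odd (a * c) := by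
    rw [hP]; exact Int.odd_iff.mpr (by omega)
  exact ⟨(Int.odd_mul.mp hac).1, ⟨k, hk⟩, (Int.odd_mul.mp hac).2⟩

end Forms

/-! ### Transport: `Aut(ℂ)` fixing `√D` and `j(τ_{Q₀}/2)` fixes `γ₃(τ_{Q₀}) = u₄(τ_{Q₀}/2)` -/

section Transport

variable {a b c : ℤ}

/-- An automorphism of `ℂ` fixing `√D` and `x = j(τ_{Q₀}/2)` fixes `g = u₄(τ_{Q₀}/2) = γ₃(τ_{Q₀})`:
level-`4` transport at the CM point of the order of conductor `2` (Bezout `4u + acw = 1`) and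
`Aut(ℂ)`-invariance of the `q`-series of `u₄ = γ₃(2τ)` (`mapLaurent_weberFourFn`).
[cite: Cox2013, §12.A (after Thm. 12.13)] [cite: ShimuraIATAF1971, §6.8] -/
theorem apply_weberFourValue_half_eq (ha : 0 < a) (hprim : IsPrimitive (a, b, c))
    (hD : b ^ 2 - 4 * a * c < 0) (hao : Odd a) (hco : Odd c) {σ : ℂ ≃+* ℂ}
    (hσ : σ (sqrtDisc (b ^ 2 - 4 * a * c)) = sqrtDisc (b ^ 2 - 4 * a * c))
    (hx : σ (formJ ((4 * a : ℤ), 2 * b, c)) = formJ ((4 * a : ℤ), 2 * b, c)) :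
    σ (weberFourValue (heegnerTau ((4 * a : ℤ), 2 * b, c))) =
      weberFourValue (heegnerTau ((4 * a : ℤ), 2 * b, c)) := by
  obtain ⟨u, w, huw⟩ := (isCoprime_four_of_odd (hao.mul hco)).symm
  have hc' : 4 * ((4 : ℕ) : ℤ) * (a * c) = (2 * b) ^ 2 - 4 * (b ^ 2 - 4 * a * c) := by
    push_cast; ring
  have huvw : u * ((4 : ℕ) : ℤ) + 0 * (2 * b) + w * (a * c) = 1 := by
    push_cast; linear_combination huw
  have hσ4 : σ (sqrtDisc (4 * (b ^ 2 - 4 * a * c))) = sqrtDisc (4 * (b ^ 2 - 4 * a * c)) := by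
    rw [sqrtDisc_four_mul, map_mul, map_ofNat, hσ]
  have hT := levelTransport_self_of_apply_formJ_eq_bezout (N := 4) (by linarith) hc' huvw hσ4
    (half_mem_heegnerForms ha hprim hco) (Int.ModEq.refl _) hx
  exact LevelTransport.apply_value_eq (N := 4) hT (mapLaurent_weberFourFn (σ : ℂ →+* ℂ))
    (pointValuation_weberFourFn_sub_lt_one _)

/-- `g² = y − 1728`: `u₄(τ_{Q₀}/2)² = j(τ_{Q₀}) − 1728`. [cite: Cox2013, §12.A (`γ₃² = j − 1728`)] -/
theorem weberFourValue_half_sq (ha : 0 < a) (hD : b ^ 2 - 4 * a * c < 0) :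
    weberFourValue (heegnerTau ((4 * a : ℤ), 2 * b, c)) ^ 2 = formJ (a, b, c) - 1728 := by
  rw [weberFourValue_sq, tpD_two_smul_heegnerTau ha hD, formJ_eq_kleinJ]

end Transport

/-! ### `g ∈ H_K(x)` and `[H_K(x) : H_K]` is odd -/

section Degree

open IntermediateField

variable {K : Type u} [Field K] [NumberField K]

/-- Two algebraic complex numbers with the same minimal polynomial over `ℚ` are conjugate under
`Aut(ℂ)`. [folklore] -/
theorem exists_ringEquiv_apply_eq_of_minpoly_eq {j₁ j₀ : ℂ} (hint₁ : IsIntegral ℚ j₁)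
    (hint₀ : IsIntegral ℚ j₀) (hmin : minpoly ℚ j₁ = minpoly ℚ j₀) :
    ∃ σ : ℂ ≃+* ℂ, σ j₁ = j₀ := by
  have hroot : j₀ ∈ (minpoly ℚ j₁).aroots ℂ := by
    rw [Polynomial.mem_aroots, hmin]
    exact ⟨minpoly.ne_zero hint₀, minpoly.aeval ℚ j₀⟩
  set φ : ℚ⟮j₁⟯ →ₐ[ℚ] ℂ := (algHomAdjoinIntegralEquiv ℚ hint₁).symm ⟨j₀, hroot⟩ with hφ
  have hφj : φ (AdjoinSimple.gen ℚ j₁) = j₀ :=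
    algHomAdjoinIntegralEquiv_symm_apply_gen ℚ hint₁ ⟨j₀, hroot⟩
  haveI : FiniteDimensional ℚ ℚ⟮j₁⟯ := adjoin.finiteDimensional hint₁
  have hcount : #(ℚ⟮j₁⟯.toSubfield) ≤ ℵ₀ :=
    Subfield.cardinalMk_le_aleph0_of_isAlgebraic ℚ⟮j₁⟯.toSubfield
  obtain ⟨σ, hσ⟩ := Complex.exists_ringEquiv_apply_eq_of_subfield ℚ⟮j₁⟯.toSubfield hcount φ.toRingHom
  refine ⟨σ, ?_⟩
  have := hσ ⟨j₁, mem_adjoin_simple_self ℚ j₁⟩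
  rw [← hφj]
  exact this

/-- **`γ₃(τ_{Q₀}) ∈ H_K(j(τ_{Q₀}/2))`** (`d_K ≡ 5 (mod 8)`): the fixed field of
`Aut(ℂ/H_K(x))` is `H_K(x)`. [cite: Cox2013, §12.A (after Thm. 12.13)] -/
theorem weberFourValue_half_mem_adjoin (hK : IsImaginaryQuadratic K) (ι : K →+* ℂ) {a b c : ℤ}
    (ha : 0 < a) (hprim : IsPrimitive (a, b, c)) (hdisc : discr (a, b, c) = NumberField.discr K)
    (hao : Odd a) (hco : Odd c) :
    weberFourValue (heegnerTau ((4 * a : ℤ), 2 * b, c)) ∈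
      adjoin (singularModuliField K ι) ({formJ ((4 * a : ℤ), 2 * b, c)} : Set ℂ) := by
  set H := singularModuliField K ι with hHdef
  set x := formJ ((4 * a : ℤ), 2 * b, c) with hxdef
  have hD : b ^ 2 - 4 * a * c < 0 := by
    have := hK.discr_neg; rw [← hdisc, QuadraticFields.BinaryQuadraticForm.discr_apply] at this
    exact this
  have hrange : Set.range (algebraMap H ℂ) = (H : Set ℂ) := by
    ext z; constructor
    · rintro ⟨y, rfl⟩; exact y.2
    · intro hz; exact ⟨⟨z, hz⟩, rfl⟩
  have hcount : #((adjoin H ({x} : Set ℂ)).toSubfield) ≤ ℵ₀ := by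
    rw [adjoin_toSubfield]
    refine (Subfield.cardinalMk_closure_le_max _).trans (max_le ?_ le_rfl)
    refine (Cardinal.mk_union_le _ _).trans ?_
    rw [Cardinal.add_le_aleph0]
    exact ⟨Cardinal.mk_range_le.trans (cardinalMk_singularModuliField_le K hK ι), by simp⟩
  refine Complex.mem_subfield_of_forall_ringEquiv _ hcount fun σ hσ ↦ ?_
  have hfixH : ∀ z ∈ H, σ z = z := fun z hz ↦
    hσ z (by
      show z ∈ (adjoin H ({x} : Set ℂ)).toSubfield
      rw [adjoin_toSubfield]
      exact Subfield.subset_closure (Or.inl (hrange ▸ hz)))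
  have hσD : σ (sqrtDisc (b ^ 2 - 4 * a * c)) = sqrtDisc (b ^ 2 - 4 * a * c) := by
    have h := apply_sqrtDisc_discr_eq hK ι fun k ↦ hfixH _ (apply_mem_singularModuliField ι k)
    rwa [← hdisc, QuadraticFields.BinaryQuadraticForm.discr_apply] at h
  have hσx : σ x = x := hσ x (subset_adjoin H ({x} : Set ℂ) rfl)
  exact apply_weberFourValue_half_eq ha hprim hD hao hco hσD hσx

/-- The roots of `Φ₂(X, j(τ_{Q₀}))` are singular moduli of primitive forms of discriminant `4d_K`
(`a, b, c` odd: `2` inert). [cite: Cox2013, §11.B (11.15)] -/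
theorem exists_form_of_eval_modularPolynomial_two_eq_zero {a b c : ℤ} (ha : 0 < a)
    (hprim : IsPrimitive (a, b, c)) (hD : b ^ 2 - 4 * a * c < 0) (hao : Odd a) (hbo : Odd b)
    (hco : Odd c) {z : ℂ}
    (hz : ((modularPolynomial 2).map (evalRingHom (kleinJ (heegnerTau (a, b, c))))).eval z = 0) :
    ∃ Q : ℤ × ℤ × ℤ, (0 < Q.1 ∧ IsPrimitive Q ∧ discr Q = 4 * (b ^ 2 - 4 * a * c)) ∧ z = formJ Q := by
  rw [eval_map_kleinJ_modularPolynomial, Finset.prod_eq_zero_iff] at hz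
  obtain ⟨i, -, hi⟩ := hz
  rw [sub_eq_zero] at hi
  rcases i with _ | k
  · refine ⟨(a, 2 * b, 4 * c), ⟨ha, isPrimitive_double hprim hao, ?_⟩, ?_⟩
    · rw [QuadraticFields.BinaryQuadraticForm.discr_apply]; ring
    · rw [hi, jConj_none, mulPoint_two_heegnerTau ha hD, formJ_eq_kleinJ]
  · refine ⟨((4 * a : ℤ), 2 * (b - 2 * a * (k.val : ℤ)), a * (k.val : ℤ) ^ 2 - b * (k.val : ℤ) + c),
      ⟨by show 0 < 4 * a; linarith, isPrimitive_half_conj hprim hao hbo hco _, ?_⟩, ?_⟩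
    · rw [QuadraticFields.BinaryQuadraticForm.discr_apply]; ring
    · rw [hi, jConj_some, divPoint_two_heegnerTau ha hD, formJ_eq_kleinJ]

/-- **`[H_K(j(τ_{Q₀}/2)) : H_K]` is odd** (`∈ {1, 3}`): `x = j(τ_{Q₀}/2)` is a root of the cubic
`Φ₂(X, j(τ_{Q₀})) ∈ H_K[X]`, and a linear cofactor would put a conjugate of `x`, hence `x` itself,
into the `Aut(ℂ)`-stable field `H_K`.  (By class field theory the degree is `h(4D)/h(D) = 3`,
Cox Thm. 7.24; not needed.) [cite: Cox2013, §12.A proof of Thm. 12.2 (degree argument)] -/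
theorem odd_finrank_adjoin_formJ_half (hK : IsImaginaryQuadratic K) (ι : K →+* ℂ) {a b c : ℤ}
    (ha : 0 < a) (hprim : IsPrimitive (a, b, c)) (hdisc : discr (a, b, c) = NumberField.discr K)
    (hao : Odd a) (hbo : Odd b) (hco : Odd c)
    [NumberField (singularModuliField K ι)] :
    Odd (Module.finrank (singularModuliField K ι)
      (adjoin (singularModuliField K ι) ({formJ ((4 * a : ℤ), 2 * b, c)} : Set ℂ))) := by
  set H := singularModuliField K ι with hHdef
  set x := formJ ((4 * a : ℤ), 2 * b, c) with hxdef
  set y := formJ (a, b, c) with hydef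
  have hD : b ^ 2 - 4 * a * c < 0 := by
    have := hK.discr_neg; rw [← hdisc, QuadraticFields.BinaryQuadraticForm.discr_apply] at this
    exact this
  have h4D : 4 * (b ^ 2 - 4 * a * c) < 0 := by linarith
  have hprim4 : IsPrimitive ((4 * a : ℤ), 2 * b, c) := isPrimitive_half hprim hco
  have hdisc4 : discr ((4 * a : ℤ), 2 * b, c) = 4 * (b ^ 2 - 4 * a * c) := by
    rw [QuadraticFields.BinaryQuadraticForm.discr_apply]; ring
  have hxint : IsIntegral ℚ x :=
    (isIntegral_int_formJ (Q := ((4 * a : ℤ), 2 * b, c)) (by show 0 < 4 * a; linarith) hprim4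
      (by rw [hdisc4]; exact h4D)).tower_top
  have hxH : IsIntegral H x := hxint.tower_top
  haveI : FiniteDimensional H (adjoin H ({x} : Set ℂ)) := adjoin.finiteDimensional hxH
  have hyH : y ∈ H := formJ_mem_singularModuliField ι ha hprim hdisc hK.discr_neg
  set r : ℕ := Module.finrank H (adjoin H ({x} : Set ℂ)) with hrdef
  have hr_eq : r = (minpoly H x).natDegree := adjoin.finrank hxH
  -- `Φ₂(X, y)` over `H`
  set y' : H := ⟨y, hyH⟩ with hy'
  set P : Polynomial H :=
    ((intModularPolynomial 2).map (mapRingHom (Int.castRingHom H))).map (evalRingHom y') with hP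
  have hPmonic : P.Monic := ((monic_intModularPolynomial 2).map _).map _
  have hPdeg : P.natDegree = 3 := by
    rw [hP, ((monic_intModularPolynomial 2).map _).natDegree_map,
      (monic_intModularPolynomial 2).natDegree_map, natDegree_intModularPolynomial]
  have hPmapC : P.map (algebraMap H ℂ) = (modularPolynomial 2).map (evalRingHom y) := by
    rw [hP, Polynomial.map_map, Polynomial.map_map, ← map_intModularPolynomial (p := 2),
      Polynomial.map_map]
    congr 1
    refine Polynomial.ringHom_ext (fun n ↦ by simp) ?_
    simp [hy']
    rfl
  have hPx : aeval x P = 0 := by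
    rw [aeval_def, eval₂_eq_eval_map, hPmapC, hydef, hxdef, formJ_eq_kleinJ (a, b, c),
      formJ_eq_kleinJ ((4 * a : ℤ), 2 * b, c), ← divPoint_two_zero_heegnerTau ha hD]
    exact modularPolynomial_kleinJ_divPoint 0 _
  have hmin_dvd : minpoly H x ∣ P := minpoly.dvd H x hPx
  have hr3 : r ≤ 3 := by
    rw [hr_eq, ← hPdeg]; exact natDegree_le_of_dvd hmin_dvd hPmonic.ne_zero
  have hr0 : 0 < r := hr_eq ▸ minpoly.natDegree_pos hxH
  have hr2 : r ≠ 2 := by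
    intro h2
    obtain ⟨q, hq⟩ := hmin_dvd
    have hqmonic : q.Monic := (minpoly.monic hxH).of_mul_monic_left (hq ▸ hPmonic)
    have hqdeg : q.natDegree = 1 := by
      have h := congrArg natDegree hq
      rw [hPdeg, natDegree_mul (minpoly.ne_zero hxH) hqmonic.ne_zero, ← hr_eq, h2] at h
      omega
    have hqe : q = X + C (q.coeff 0) := hqmonic.eq_X_add_C hqdeg
    set e : H := -q.coeff 0 with he
    have hPe : P.eval e = 0 := by
      rw [hq, eval_mul, hqe]; simp [he]
    have hPe' : ((modularPolynomial 2).map (evalRingHom y)).eval (e : ℂ) = 0 := by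
      rw [← hPmapC, eval_map, show ((e : H) : ℂ) = algebraMap H ℂ e from rfl, eval₂_at_apply, hPe,
        map_zero]
    rw [hydef, formJ_eq_kleinJ] at hPe'
    obtain ⟨Q', ⟨hA', hprim', hdisc'⟩, he'⟩ :=
      exists_form_of_eval_modularPolynomial_two_eq_zero ha hprim hD hao hbo hco hPe'
    -- `e` and `x` are conjugate over `ℚ`; `H` is `Aut(ℂ)`-stable, so `x ∈ H`
    have heint : IsIntegral ℚ (e : ℂ) := by
      rw [he']; exact (isIntegral_int_formJ hA' hprim' (by rw [hdisc']; exact h4D)).tower_top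
    have hmin : minpoly ℚ (e : ℂ) = minpoly ℚ x := by
      have hSint := isIntegral_rat_of_mem_image_formJ h4D
      rw [he', hxdef, minpoly_formJ_eq_principalForm h4D hSint hA' hprim' hdisc',
        minpoly_formJ_eq_principalForm h4D hSint (by show 0 < 4 * a; linarith) hprim4 hdisc4]
    obtain ⟨φ, hφ⟩ := exists_ringEquiv_apply_eq_of_minpoly_eq heint hxint hmin
    have hxmem : x ∈ H := hφ ▸ ringEquiv_apply_mem_singularModuliField hK ι φ e.2
    have hr1 : r = 1 := by
      rw [hr_eq]
      have hdeg1 : (minpoly H x).degree = 1 :=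
        minpoly.degree_eq_one_iff.mpr ⟨⟨x, hxmem⟩, rfl⟩
      exact (degree_eq_iff_natDegree_eq (minpoly.ne_zero hxH)).mp hdeg1
    omega
  have hr13 : r = 1 ∨ r = 3 := by omega
  rcases hr13 with h | h <;> rw [h] <;> decide

end Degree

/-! ### Main theorems -/

section Main

open IntermediateField

variable {K : Type u} [Field K] [NumberField K]

/-- **`(j(τ_{Q₀}) − 1728)` is the square of an ideal of `𝓞 H_K` for `d_K ≡ 5 (mod 8)`** (`2` inert):
`γ₃(τ_{Q₀}) = √(j(τ_{Q₀}) − 1728)` lies in the odd-degree extension `H_K(j(τ_{Q₀}/2))` of `H_K`,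
so every prime of `H_K` has even exponent in `(j(τ_{Q₀}) − 1728)`
(`exists_span_eq_sq_of_odd_finrank`).  Classically `γ₃(τ₀)√d_K ∈ ℚ(j(τ₀))` for odd `d_K`
(Weber, Birch, Schertz); only this ideal-theoretic shadow is proved here.
[cite: Cox2013, §12.A (after Thm. 12.13, `γ₃`; Schertz [A19, Thm. 3])] -/
theorem exists_span_formJ_sub_eq_sq_of_inert (hK : IsImaginaryQuadratic K)
    (h8 : NumberField.discr K % 8 = 5) (ι : K →+* ℂ) {Q₀ : ℤ × ℤ × ℤ} (hA₀ : 0 < Q₀.1)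
    (hprim₀ : IsPrimitive Q₀) (hdisc₀ : discr Q₀ = NumberField.discr K)
    (j₀ : 𝓞 (singularModuliField K ι)) (hj₀ : ((j₀ : singularModuliField K ι) : ℂ) = formJ Q₀) :
    ∃ 𝔟 : Ideal (𝓞 (singularModuliField K ι)), Ideal.span {j₀ - 1728} = 𝔟 ^ 2 := by
  -- the trivial case `j = 1728`
  by_cases h0 : j₀ - 1728 = 0
  · exact ⟨⊥, by rw [h0, Ideal.span_singleton_eq_bot.mpr rfl, ← Ideal.zero_eq_bot, zero_pow two_ne_zero]⟩
  obtain ⟨a, b, c⟩ := Q₀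
  simp only at hA₀
  have hdisc : b ^ 2 - 4 * a * c = NumberField.discr K := by
    rw [← hdisc₀, QuadraticFields.BinaryQuadraticForm.discr_apply]
  have hD : b ^ 2 - 4 * a * c < 0 := hdisc ▸ hK.discr_neg
  obtain ⟨hao, hbo, hco⟩ := odd_of_discr_emod_eight (a := a) (b := b) (c := c) (by rw [hdisc]; exact h8)
  haveI hNF : NumberField (singularModuliField K ι) :=
    numberField_singularModuliField irreducible_classPolynomial_holds hK ι
  set x := formJ ((4 * a : ℤ), 2 * b, c) with hxdef
  set M : IntermediateField (singularModuliField K ι) ℂ :=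
    adjoin (singularModuliField K ι) ({x} : Set ℂ) with hMdef
  have h4D : 4 * (b ^ 2 - 4 * a * c) < 0 := by linarith
  have hprim4 : IsPrimitive ((4 * a : ℤ), 2 * b, c) := isPrimitive_half hprim₀ hco
  have hdisc4 : discr ((4 * a : ℤ), 2 * b, c) = 4 * (b ^ 2 - 4 * a * c) := by
    rw [QuadraticFields.BinaryQuadraticForm.discr_apply]; ring
  have hxint : IsIntegral ℚ x :=
    (isIntegral_int_formJ (Q := ((4 * a : ℤ), 2 * b, c)) (by show 0 < 4 * a; linarith) hprim4
      (by rw [hdisc4]; exact h4D)).tower_top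
  have hxH : IsIntegral (singularModuliField K ι) x := hxint.tower_top
  haveI : FiniteDimensional (singularModuliField K ι) M := adjoin.finiteDimensional hxH
  haveI : FiniteDimensional ℚ M := Module.Finite.trans (singularModuliField K ι) M
  haveI : NumberField M := NumberField.mk
  have hodd : Odd (Module.finrank (singularModuliField K ι) M) :=
    odd_finrank_adjoin_formJ_half hK ι hA₀ hprim₀ hdisc₀ hao hbo hco
  -- `g = γ₃(τ_{Q₀}) ∈ M`, `g² = j − 1728`
  set g := weberFourValue (heegnerTau ((4 * a : ℤ), 2 * b, c)) with hgdef
  have hgM : g ∈ M := weberFourValue_half_mem_adjoin hK ι hA₀ hprim₀ hdisc₀ hao hco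
  have hg2 : g ^ 2 = formJ (a, b, c) - 1728 := weberFourValue_half_sq hA₀ hD
  have hjint : IsIntegral ℤ (formJ (a, b, c)) :=
    isIntegral_int_formJ hA₀ hprim₀ (by rw [hdisc₀]; exact hK.discr_neg)
  have h1728 : IsIntegral ℤ (1728 : ℂ) := by
    have h := isIntegral_algebraMap (R := ℤ) (A := ℂ) (x := 1728)
    simpa using h
  have hgint : IsIntegral ℤ g := IsIntegral.of_pow (by norm_num : 0 < 2) (by rw [hg2]; exact hjint.sub h1728)
  have hgintM : IsIntegral ℤ (⟨g, hgM⟩ : M) :=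
    (isIntegral_algHom_iff (M.val.restrictScalars ℤ) Subtype.val_injective).mp hgint
  set g' : 𝓞 M := ⟨⟨g, hgM⟩, hgintM⟩ with hg'
  -- the equation `j₀ − 1728 = g'²` in `𝓞 M`
  have hinj : Function.Injective
      ((algebraMap M ℂ).comp (algebraMap (𝓞 M) M)) :=
    (algebraMap M ℂ).injective.comp RingOfIntegers.coe_injective
  have heq : algebraMap (𝓞 (singularModuliField K ι)) (𝓞 M) (j₀ - 1728) = g' ^ 2 := by
    apply hinj
    simp only [RingHom.coe_comp, Function.comp_apply, map_sub, map_pow, map_ofNat]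
    have h1 : algebraMap M ℂ (algebraMap (𝓞 M) M
        (algebraMap (𝓞 (singularModuliField K ι)) (𝓞 M) j₀)) =
        ((j₀ : singularModuliField K ι) : ℂ) := rfl
    have h2 : algebraMap M ℂ (algebraMap (𝓞 M) M g') = g := rfl
    rw [h1, h2, hg2, hj₀]
  exact exists_span_eq_sq_of_odd_finrank (K := singularModuliField K ι) (L := M) hodd h0 heq

/-- **For odd `d_K`, `(j(τ_{Q₀}) − 1728) = 𝔟²` in `𝓞 H_K`** — the split case
(`exists_span_formJ_sub_eq_sq`, `d_K ≡ 1 (mod 8)`, an element square) and the inert case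
(`exists_span_formJ_sub_eq_sq_of_inert`, `d_K ≡ 5 (mod 8)`) combined.
[cite: Cox2013, §12.A (after Thm. 12.13, `γ₃`)] -/
theorem exists_span_formJ_sub_eq_sq_of_odd (hK : IsImaginaryQuadratic K)
    (hodd : Odd (NumberField.discr K)) (ι : K →+* ℂ) {Q₀ : ℤ × ℤ × ℤ} (hA₀ : 0 < Q₀.1)
    (hprim₀ : IsPrimitive Q₀) (hdisc₀ : discr Q₀ = NumberField.discr K)
    (j₀ : 𝓞 (singularModuliField K ι)) (hj₀ : ((j₀ : singularModuliField K ι) : ℂ) = formJ Q₀) :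
    ∃ 𝔟 : Ideal (𝓞 (singularModuliField K ι)), Ideal.span {j₀ - 1728} = 𝔟 ^ 2 := by
  have h4 : NumberField.discr K % 4 = 0 ∨ NumberField.discr K % 4 = 1 := discr_emod_four hK.1
  have h18 : NumberField.discr K % 8 = 1 ∨ NumberField.discr K % 8 = 5 := by
    rcases hodd with ⟨k, hk⟩
    omega
  rcases h18 with h | h
  · obtain ⟨w, hw⟩ := exists_span_formJ_sub_eq_sq hK h ι hA₀ hprim₀ hdisc₀ j₀ hj₀
    exact ⟨Ideal.span {w}, hw⟩
  · exact exists_span_formJ_sub_eq_sq_of_inert hK h ι hA₀ hprim₀ hdisc₀ j₀ hj₀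

end Main

end Literature.NumberTheory.EllipticCurves

end
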